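import Summits.ValiantsHypothesis.ValiantsHypothesis.Theses.LangWeilTransfer
import Summits.ValiantsHypothesis.ValiantsHypothesis.Theorems.LangWeilTransferAssemblyPrelims
import Literature.Computability.AlgebraicComplexity.CircuitCoeffIdeal
import Literature.Computability.AlgebraicComplexity.ArithCircuitProjections
import Literature.Computability.AlgebraicComplexity.ArithCircuitProofs
import Literature.Computability.AlgebraicComplexity.RealTauConjectureDepthFour
import Literature.Computability.AlgebraicComplexity.StandardFamilies

/-!
# LangWeilTransfer, item `Assembly` (stmt-ValiantsHypothesis-6382) — cheap `per_n` modulo a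
# small prime from `ShatteringExclusion`, `TameTransfer`, `ScalarRestriction`

Route `LangWeilTransfer` of `ValiantsHypothesis`. The algebraic core of the assembly (Bürgisser's
(A3) pipeline with Thm 4.1 replaced by the route's cruxes): if `per_n` has fan-in-two circuits of
size `≤ n^c` (for `n ≥ 2`), then for all large `n` there are a prime `p > 2^{n+1}` and `r ≥ 1` with
`p^r ≤ 2^{(n+2)^e}` and `L_{ℤ/p}(per_n) ≤ (n+2)^e` (`modP_per_of_cruxes`):

1. `ShatteringExclusion` upgrades the circuit to one, `P`, whose coefficient ideal
   (`circuitCoeffIdeal P per_n` — the route's ideal `I` VERBATIM) has a minimal prime with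
   `≤ n^{d₀}` geometric components;
2. the finitely many generators `circuitCoeffPoly P per_n α`, `α ∈ circuitCoeffSupport P per_n`
   (`circuitCoeffIdeal_eq_span_image`), have degree `≤ 2^{3s}`, weight `≤ 2^{2^{3s}} + n!` and are
   `≤ (2^{3s}+1)^{n²+4s+1} + (n+1)^{n²}` in number (AssemblyPrelims), so `TameTransfer` yields a
   prime `p > 2^{n+1}`, `r`, and a common zero `z ∈ GaloisField p r` with `p^r ≤ 2^{poly(n)}`;
3. `forall_aeval_circuitCoeffPoly_eq_zero_iff`: plugging `z` into the integer skeleton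
   (`ArithCircuit.substVC`) gives a fan-in-two circuit of size `3s` over `GaloisField p r`
   computing `per_n`;
4. `ScalarRestriction` descends it to `ℤ/p` at cost `A (r+1)^3 (3s+1)`.

All exponent bookkeeping goes through one parameter `M = (n+2)^{c'+d₀+1} ≥ 2` dominating `n`,
`s`, `B`. Honest framing: conditional bookkeeping (the three cruxes are hypotheses; they and
`P^#P ⊄ P/poly` are open); `VP ≠ VNP` is NOT proved.

## References

* P. Bürgisser, *Cook's versus Valiant's hypothesis*, TCS 235 (2000), Thm 4.1, Cor 4.8, §5 (A3)
  pp. 85–86. [cite: Burgisser2000TCS, §5 (A3)]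
-/

-- the summit and the problem share the name `ValiantsHypothesis` (D-0017 single-conjunct layout)
set_option linter.dupNamespace false

noncomputable section

open MvPolynomial

namespace Summit.ValiantsHypothesis.ValiantsHypothesis.Theorems.LangWeilTransfer

open Summit.ValiantsHypothesis.ValiantsHypothesis.Theses.LangWeilTransfer
open Literature.Computability.AlgebraicComplexity ArithCircuit

/-! ### Plugging a point into the skeleton -/

/-- **A common zero of the coefficient identities over a commutative ring `K` gives a fan-in-two
circuit of size `3s` over `K` computing `per_n`** (the integer skeleton with the point substituted
for the slot indeterminates; Bürgisser 2000 TCS §5 (A3) p. 85 "simulate `Γ_n` … with constants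
`y^{(n)}`"). [cite: Burgisser2000TCS, §5 (A3)] -/
theorem exists_circuit_of_zero {K : Type} [CommRing K] {n : ℕ} (P : ArithCircuit ℂ (Fin n × Fin n))
    (z : Fin (4 * P.size + 1) → K)
    (hz : ∀ α, aeval z (circuitCoeffPoly P (perPoly (Fin n) ℤ) α) = 0) :
    ∃ Q : ArithCircuit K (Fin n × Fin n), Q.IsFanInTwo ∧ Q.Computes (perPoly (Fin n) K) ∧
      Q.size = 3 * P.size := by
  classical
  have hF := (forall_aeval_circuitCoeffPoly_eq_zero_iff P (perPoly (Fin n) ℤ) z).1 hz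
  rw [map_perPoly] at hF
  set s : (Fin n × Fin n) ⊕ Fin (4 * P.size + 1) → (Fin n × Fin n) ⊕ K :=
    Sum.elim (fun x => Sum.inl x) (fun v => Sum.inr (z v)) with hs
  refine ⟨((skeleton P).map (Int.castRingHom K)).substVC s, ?_, ?_, ?_⟩
  · intro g hg
    simp only [substVC, List.mem_map] at hg
    obtain ⟨g', hg', rfl⟩ := hg
    rw [Gate.fanIn_substVC]
    exact (isFanInTwo_skeleton P).map (Int.castRingHom K) g' hg'
  · have hmap : MvPolynomial.map (Int.castRingHom K) (skeleton P).eval =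
        MvPolynomial.map (algebraMap ℤ K) (skeleton P).eval := by rw [algebraMap_int_eq]
    have hfun : substVCFun s =
        (Sum.elim X fun v => C (z v) : _ → MvPolynomial (Fin n × Fin n) K) := by
      funext x
      rcases x with x | v <;> simp [substVCFun, hs]
    rw [Computes, eval_substVC, eval_map_apply, hmap,
      aeval_map_algebraMap (A := K) (substVCFun s) (skeleton P).eval, hfun]
    exact hF
  · rw [size_substVC, size_map, size_skeleton]

/-! ### Exponent bookkeeping through one dominating parameter -/

/-- Constants are dominated: `k ≤ M^k` for `M ≥ 2`. [folklore] -/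
theorem le_pow_of_two_le {M k : ℕ} (hM : 2 ≤ M) : k ≤ M ^ k :=
  (Nat.lt_two_pow_self).le.trans (Nat.pow_le_pow_left hM k)

/-- The `TameTransfer` input size is `≤ M^9` when `n, s, B ≤ M`, `2 ≤ M`. [folklore] -/
theorem transfer_input_le {M n s B : ℕ} (hM : 2 ≤ M) (hn : n ≤ M) (hs : s ≤ M) (hB : B ≤ M) :
    B + (n + 1) + (4 * s + 1) + Nat.log 2 (2 ^ (3 * s)) +
        Nat.log 2 (Nat.log 2 (2 ^ 2 ^ (3 * s) + n.factorial)) +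
        Nat.log 2 ((2 ^ (3 * s) + 1) ^ (n * n + (4 * s + 1)) + (n + 1) ^ (n * n)) + 2 ≤ M ^ 9 := by
  have h1 : Nat.log 2 (2 ^ (3 * s)) = 3 * s := Nat.log_pow (by norm_num) _
  have h2 := log_log_weight_le s n
  have h3 := log_card_le (t := (2 ^ (3 * s) + 1) ^ (n * n + (4 * s + 1)) + (n + 1) ^ (n * n))
    (s := s) (n := n) le_rfl
  rw [h1]
  have hM1 : 1 ≤ M := by omega
  have hnn : n * n ≤ M * M := Nat.mul_le_mul hn hn
  have key : B + (n + 1) + (4 * s + 1) + 3 * s + (3 * s + n * n + 1) +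
      ((3 * s + 1) * (n * n + 4 * s + 1) + n * (n * n) + 1) + 2 ≤ 42 * M ^ 3 := by
    have e1 : (3 * s + 1) * (n * n + 4 * s + 1) ≤ (3 * M + 1) * (M * M + 4 * M + 1) :=
      Nat.mul_le_mul (by omega) (by omega)
    have e2 : n * (n * n) ≤ M * (M * M) := Nat.mul_le_mul hn hnn
    nlinarith
  have h42 : 42 * M ^ 3 ≤ M ^ 9 := by
    have : 42 ≤ M ^ 6 := by
      calc 42 ≤ 2 ^ 6 := by norm_num
        _ ≤ M ^ 6 := Nat.pow_le_pow_left hM 6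
    calc 42 * M ^ 3 ≤ M ^ 6 * M ^ 3 := Nat.mul_le_mul_right _ this
      _ = M ^ 9 := by rw [← pow_add]
  omega

/-- The final size is `≤ M^(27a + A + 6)` when `r ≤ M^(9a)`, `s ≤ M`, `2 ≤ M`. [folklore] -/
theorem final_size_le {M A a r s : ℕ} (hM : 2 ≤ M) (hs : s ≤ M) (hr : r ≤ M ^ (9 * a)) :
    A * (r + 1) ^ 3 * (3 * s + 1) ≤ M ^ (27 * a + A + 6) := by
  have hM1 : 1 ≤ M := by omega
  have hMa : 1 ≤ M ^ (9 * a) := Nat.one_le_pow _ _ (by omega)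
  have h1 : (r + 1) ^ 3 ≤ 8 * M ^ (27 * a) := by
    calc (r + 1) ^ 3 ≤ (2 * M ^ (9 * a)) ^ 3 := Nat.pow_le_pow_left (by omega) 3
      _ = 8 * M ^ (27 * a) := by rw [mul_pow, ← pow_mul]; ring_nf
  have h2 : 3 * s + 1 ≤ 4 * M := by omega
  have h3 : A * 32 ≤ M ^ (A + 5) := by
    calc A * 32 ≤ 2 ^ A * 2 ^ 5 := Nat.mul_le_mul (Nat.lt_two_pow_self).le (by norm_num)
      _ = 2 ^ (A + 5) := by rw [← pow_add]
      _ ≤ M ^ (A + 5) := Nat.pow_le_pow_left hM _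
  calc A * (r + 1) ^ 3 * (3 * s + 1) ≤ A * (8 * M ^ (27 * a)) * (4 * M) :=
        Nat.mul_le_mul (Nat.mul_le_mul_left _ h1) h2
    _ = A * 32 * (M ^ (27 * a) * M) := by ring
    _ ≤ M ^ (A + 5) * (M ^ (27 * a) * M) := Nat.mul_le_mul_right _ h3
    _ = M ^ (27 * a + A + 6) := by rw [← pow_succ, ← pow_add]; ring_nf

/-! ### The pipeline for large `n` -/

/-- **Cheap `per_n` modulo a small prime, for all large `n`** (the (A3) pipeline of the route with
Thm 4.1 replaced by `ShatteringExclusion` + `TameTransfer` + `ScalarRestriction`): if `per_n`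
has fan-in-two circuits of size `≤ n^c` for `n ≥ 2`, there are `e, N₀` such that for `n ≥ N₀`
some prime `p > 2^{n+1}` and `r ≥ 1` satisfy `p^r ≤ 2^{(n+2)^e}` and
`L_{ℤ/p}(per_n) ≤ (n+2)^e`. [cite: Burgisser2000TCS, §5 (A3)] -/
theorem modP_per_of_cruxes (hSE : ShatteringExclusion) (hTT : TameTransfer)
    (hSR : ScalarRestriction) {c : ℕ}
    (hc : ∀ n, 2 ≤ n → ∃ P : ArithCircuit ℂ (Fin n × Fin n),
      P.IsFanInTwo ∧ P.size ≤ n ^ c ∧ P.Computes (perPoly (Fin n) ℂ)) :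
    ∃ e N₀ : ℕ, ∀ n, N₀ ≤ n → ∃ p r : ℕ, p.Prime ∧ 2 ^ (n + 1) < p ∧ 0 < r ∧
      p ^ r ≤ 2 ^ ((n + 2) ^ e) ∧ complexity (perPoly (Fin n) (ZMod p)) ≤ (n + 2) ^ e := by
  classical
  obtain ⟨c', d₀, N, hSE'⟩ := hSE c
  obtain ⟨a, hTT'⟩ := hTT
  obtain ⟨A, hSR'⟩ := hSR
  refine ⟨(c' + d₀ + 1) * (27 * a + A + 6), max N 2, fun n hn => ?_⟩
  have hn2 : 2 ≤ n := le_trans (le_max_right _ _) hn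
  obtain ⟨P, hP2, hPs, hPc, I, hI, 𝔭, h𝔭, hpos, hB⟩ :=
    hSE' n (le_trans (le_max_left _ _) hn) (hc n hn2)
  -- the finite generating family of the coefficient ideal
  set g : MvPolynomial (Fin n × Fin n) ℤ := perPoly (Fin n) ℤ with hg
  set Sup := circuitCoeffSupport P g with hSup
  set t := Sup.card with ht
  let enum : Fin t ≃ Sup := Sup.equivFin.symm
  set S : Fin t → MvPolynomial (Fin (4 * P.size + 1)) ℤ :=
    fun i => circuitCoeffPoly P g (enum i : Fin n × Fin n →₀ ℕ) with hS
  have hIeq : I = circuitCoeffIdeal P g := by rw [hI]; rfl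
  have hspan : Ideal.span (Set.range fun i => map (Int.castRingHom ℚ) (S i)) = I := by
    rw [hIeq, circuitCoeffIdeal_eq_span_image]
    congr 1
    ext f
    constructor
    · rintro ⟨i, rfl⟩
      exact ⟨(enum i : Fin n × Fin n →₀ ℕ), (enum i).2, rfl⟩
    · rintro ⟨α, hα, rfl⟩
      exact ⟨enum.symm ⟨α, hα⟩, by simp [hS]⟩
  have hdeg : ∀ i, (S i).totalDegree ≤ 2 ^ (3 * P.size) := fun i =>
    totalDegree_circuitCoeffPoly_le P g _
  have hwt : ∀ i, weight (S i) ≤ 2 ^ 2 ^ (3 * P.size) + n.factorial := fun i =>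
    weight_circuitCoeffPoly_perPoly_le P _
  -- TameTransfer
  obtain ⟨p, r, hpF, hT, hr, hpr, z, hz⟩ := hTT' (4 * P.size + 1) t (2 ^ (3 * P.size))
    (2 ^ 2 ^ (3 * P.size) + n.factorial) (n ^ d₀) (n + 1) S hdeg hwt
    ⟨𝔭, by rw [hspan]; exact h𝔭, hpos, hB⟩
  haveI : Fact p.Prime := hpF
  -- every coefficient identity vanishes at `z`
  have hall : ∀ α, aeval z (circuitCoeffPoly P g α) = 0 := by
    intro α
    by_cases hα : α ∈ Sup
    · have := hz (enum.symm ⟨α, hα⟩)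
      simpa [hS] using this
    · rw [circuitCoeffPoly_eq_zero_of_not_mem hα, map_zero]
  -- the circuit over `GaloisField p r` and its descent to `ℤ/p`
  obtain ⟨Q, hQ2, hQc, hQs⟩ := exists_circuit_of_zero (K := GaloisField p r) P z hall
  obtain ⟨P', hP'2, hP'c, hP's⟩ := hSR' p r (Fin n × Fin n) (perPoly (Fin n) (ZMod p)) Q hQ2
    (by rw [map_perPoly]; exact hQc)
  have hcx : complexity (perPoly (Fin n) (ZMod p)) ≤ A * (r + 1) ^ 3 * (3 * P.size + 1) := by
    rw [← hQs]; exact (complexity_le_size hP'2 hP'c).trans hP's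
  -- bookkeeping through `M = (n+2)^(c'+d₀+1)`
  set M := (n + 2) ^ (c' + d₀ + 1) with hM
  have hM2 : 2 ≤ M := by
    calc 2 ≤ n + 2 := by omega
      _ ≤ (n + 2) ^ (c' + d₀ + 1) := Nat.le_self_pow (by omega) _
  have hnM : n ≤ M := by
    calc n ≤ n + 2 := by omega
      _ ≤ (n + 2) ^ (c' + d₀ + 1) := Nat.le_self_pow (by omega) _
  have hpow_le : ∀ k, k ≤ c' + d₀ + 1 → n ^ k ≤ M := fun k hk =>
    calc n ^ k ≤ (n + 2) ^ k := Nat.pow_le_pow_left (by omega) k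
      _ ≤ (n + 2) ^ (c' + d₀ + 1) := Nat.pow_le_pow_right (by omega) hk
  have hsM : P.size ≤ M := hPs.trans (hpow_le c' (by omega))
  have hBM : n ^ d₀ ≤ M := hpow_le d₀ (by omega)
  have htle : t ≤ (2 ^ (3 * P.size) + 1) ^ (n * n + (4 * P.size + 1)) + (n + 1) ^ (n * n) :=
    card_circuitCoeffSupport_le P
  -- the input size of `TameTransfer` is `≤ M^9`, so `p^r ≤ 2^(M^(9a))`
  have hX : n ^ d₀ + (n + 1) + (4 * P.size + 1) + Nat.log 2 (2 ^ (3 * P.size)) +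
      Nat.log 2 (Nat.log 2 (2 ^ 2 ^ (3 * P.size) + n.factorial)) + Nat.log 2 t + 2 ≤ M ^ 9 := by
    refine le_trans ?_ (transfer_input_le hM2 hnM hsM hBM)
    have := Nat.log_mono_right (b := 2) htle
    omega
  have hpr' : p ^ r ≤ 2 ^ (M ^ (9 * a)) := by
    refine hpr.trans (Nat.pow_le_pow_right (by norm_num) ?_)
    calc _ ≤ (M ^ 9) ^ a := Nat.pow_le_pow_left hX a
      _ = M ^ (9 * a) := by rw [← pow_mul]
  have hp2 : 2 ≤ p := hpF.out.two_le
  have hrM : r ≤ M ^ (9 * a) := by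
    have h1 : 2 ^ r ≤ p ^ r := Nat.pow_le_pow_left hp2 r
    exact (Nat.pow_le_pow_iff_right (by norm_num)).1 (h1.trans hpr')
  have hsize : A * (r + 1) ^ 3 * (3 * P.size + 1) ≤ M ^ (27 * a + A + 6) :=
    final_size_le hM2 hsM hrM
  have hMe : ∀ k, k ≤ 27 * a + A + 6 → M ^ k ≤ (n + 2) ^ ((c' + d₀ + 1) * (27 * a + A + 6)) :=
    fun k hk => by
      rw [hM, ← pow_mul]
      exact Nat.pow_le_pow_right (by omega) (Nat.mul_le_mul_left _ hk)
  refine ⟨p, r, hpF.out, hT, hr, hpr'.trans (Nat.pow_le_pow_right (by norm_num) (hMe _ ?_)),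
    hcx.trans (hsize.trans (hMe _ le_rfl))⟩
  omega

end Summit.ValiantsHypothesis.ValiantsHypothesis.Theorems.LangWeilTransfer

end
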